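import Literature.MathematicalPhysics.QuantumFieldTheory.Balaban1983to89.Node00.CriticalOnFibreTopCore
import Literature.MathematicalPhysics.QuantumFieldTheory.Balaban1983to89.Node00.TkFirstStepRegionVanishing
import Summits.QuantumFields.YangMills.Theorems.BalabanUVNodesK0VariationalThm1OuterRange
import Summits.QuantumFields.YangMills.Theorems.BalabanUVNodesN07LocalLettersCoreGuardedDatumB
import Summits.QuantumFields.YangMills.Theorems.BalabanUVNodesN07RecordDomainsAdm22
import Literature.MathematicalPhysics.QuantumFieldTheory.Balaban1983to89.Node00.CriticalOnFibreTopGuardedBPrint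
import HarnessLib

/-!
# BalabanUVNodes ∕ K0⁷ — THE CORE-TO-TOP CHAIN AT PRINT's [II] (2.3) DATUM AND PRINT's (7) DATA: `DatumGaugeSplitTopStepCoreGB … (lamDatum F) (dataSmall7LamTopOf F N) …`
# ⟹ `HalvingStepTopCoreGB … (lamPlaqs0Of F)` ⟹ `HalvingStepTopGB` ⟹ `Prop8RegSepTopStepGB …` (S1c of the (E1)∕(iii-b) work plan, director-ym №338∕№339; FLAG №16; LOCATE-HSEAM
# 5d3298b8d191f169) — the print-datum twin of `K0HalvingStepOfCore{,Floor,GuardedChain}`'s link, AT PRINT's LEVEL-0 EXCLUSION RANGE `lamPlaqs0Of F` («p′ ⊂ Λ₀», [II] p. 224 ruling (α))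

Cell `pub-ymgap`, seat `pub-ymgap-dag-n07-e` g34 (LANE OWNER of the K0 road chart side).  `--kind proof --supports stmt-QuantumFields-20541 --as helper` (K0⁷); count-neutral; def-free.
PRINT-DATUM TWIN of p586684 §1–§2 ∕ `…OfCoreFloor` §1∕§3 ∕ `…OfCoreGuardedChain` §1 and of dag-n07-w4's ∃-introduction; the (b)-instances stay landed and true on their own text; no premise
deleted except by RE-KEYING to print's objects; two guard letters displayed (`k ≤ m + K`, grid numerics); v1.0 prose (why `Ex0 := lamPlaqs0Of F`): ledger copy of p766707.
WHAT IS PROVED (sorry-free; axioms standard).  §0′ PRIVATE re-homes (v1.1); §1 `mem_lamPlaqs_zero_of_corners`, `plaqHol_eq_of_agreeOnB_of_mem_lamPlaqs_zero`, ★ `dist1_plaqHol_lt_of_mem_lamPlaqs`,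
★ `norm_coDivSum_le_of_mem_bondsDeep_compl_lam`; §2 ★★ `halvingStep_top_of_core_at_lam`, ★★ `halvingStepTopGB_of_coreGB_lam`, ★ `prop8RegSepTopStepGB_of_coreGB_lam`; §3 `Sect2.mem_plaqsOf_one_of_not_mem_lamPlaqs_zero`,
`Sect2.exists_level_of_core_plaq_lam`, ★★ `localLettersSplitCoreGB_of_datumGaugeSplitCoreGB_lam`, ★★ `halvingStepTopCoreGB_of_datumGaugeSplitCoreGB_lam`, ★★★ `prop8RegSepTopStepGB_of_datumGaugeSplitCoreGB_lam`
(the chain END TO END at `(lamDatum F, dataSmall7LamTopOf F N)`; letters `2L² ≤ B₃`, `4C ≤ B₃`, `16θ ≤ 1`, `(16Q + 1024κ²)a₀ ≤ 1`, `32κa₀ ≤ 1`).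
HONEST SCOPE.  Count-neutral helpers; the per-datum token is a displayed HYPOTHESIS; nothing of [15]∕[6]∕[II] analysis asserted; no (b)-instance claimed false; K0⁷ ∕ K1⁹ NOT closed; N07 NOT
discharged; counts unmoved (typed 28∕28 · discharged 8∕28); finite 𝕋⁴ at fixed ε — the route closes the conditional finite-𝕋⁴ rung `BalabanLadder.UV` ONLY; the YM mass gap (Clay) is NOT
proved; nothing continuum ∕ ℝ⁴ ∕ OS.  No `sorry` ∕ `def` ∕ `instance` ∕ `notation`.  [15] = [Balaban1985Variational]; [6] = [Balaban1985RegularSpaces]; [II] = [Balaban1984PropagatorsII];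
[III] = [Balaban1988Convergent]; [I] = [Balaban1987RG1].  v1.1 (director-ym №365 (2)–(4), row group 13′ — imports re-pointed + PRIVATE re-homes + every existing declaration
BYTE-IDENTICAL; lint-clean in place): `import …K0HalvingStepOfCore` (residue after the Stage-2 seam: socket-typed §3) ↦ its three green parents; header compressed for the 400-line limit.
-/

set_option autoImplicit false
noncomputable section
namespace Summit.QuantumFields.YangMills.Theorems.K0HalvingStepOfCoreB

open scoped Matrix.Norms.L2Operator
open Literature.MathematicalPhysics.QuantumFieldTheory.Balaban1983to89
open Literature.MathematicalPhysics.QuantumFieldTheory.Balaban1983to89.Node00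
open Literature.MathematicalPhysics.QuantumFieldTheory.Balaban1983to89.T4Continuum
open B15DeterminingSets B15DeterminingSetsB
open B15Eq112TorusCover (cover lift)
open B14DomainGeom (Pt Within cubeIdx)
open B14.Eq213MaximalDomains (side cubeExt)
open B5Eq118OneStroke (iterBlockOf)
open Summit.QuantumFields.YangMills.Theorems.K0VariationalThm1OuterRange (mem_printedPlaqs_zero_iff_bonds mem_bondsOf_genSet_zero_iff)
open Summit.QuantumFields.YangMills.BalabanUVNodes.N07LocalLettersCoreGuardedB (LocalLettersSplitTopStepCoreGB DatumGaugeSplitTopStepCoreGB halvingStepTopCoreGB_of_localLettersSplitCoreGB)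
open Summit.QuantumFields.YangMills.BalabanUVNodes.N07LocalLettersCoreOfDatumGauges (mem_cubeExt_cubeIdx exists_within_three_of_mem_plaqsOf exists_within_three_of_not_mem_bondsDeep_compl)
open Summit.QuantumFields.YangMills.BalabanUVNodes.N07LocalLettersCoreFloor
open Summit.QuantumFields.YangMills.BalabanUVNodes.N07RecordDomainsAdm22 (blockSat_seqOfRecord)

/-! ## §0  Site bookkeeping -/

section Sites
variable {P : Params}
/-- `(y − e_ν) + e_ν = y` on the torus. [cite: Balaban1987RG1, (0.1) p.251 (bookkeeping)] -/
private theorem shift_unshift_site_b (y : Site P 0) (ν : Fin P.d) : (y.unshift ν).shift ν = y := by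
  funext κ
  by_cases h : κ = ν
  · subst h; simp [Site.shift, Site.unshift]
  · simp [Site.shift, Site.unshift, Function.update_of_ne h]

/-- `(x − e_ν) + e_μ = (x + e_μ) − e_ν` on the torus. [cite: Balaban1987RG1, (0.1) p.251 (bookkeeping)] -/
private theorem unshift_shift_comm_site_b (x : Site P 0) (μ ν : Fin P.d) : (x.unshift ν).shift μ = (x.shift μ).unshift ν :=
  (Site.unshift_shift_comm x μ ν).symm

/-- `(x + e_ν) + e_μ = (x + e_μ) + e_ν` on the torus (`μ ≠ ν`). [cite: Balaban1987RG1, (0.1) p.251 (bookkeeping)] -/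
private theorem shift_shift_comm_site_b (x : Site P 0) {μ ν : Fin P.d} (hne : μ ≠ ν) : (x.shift ν).shift μ = (x.shift μ).shift ν := by
  simp only [Site.shift, Function.update_of_ne hne, Function.update_of_ne hne.symm]
  exact Function.update_comm hne.symm _ _ _

end Sites
/-! ## §0′  PRIVATE RE-HOME of the p586684 lemma this file consumes (director-ym №365 (2)–(4), row group 13′; statement + proof verbatim, `private`; `suppDomOfRecord_one_subset` inlined) -/
/-- PRIVATE RE-HOME (director-ym №365 (2)–(4), row group 13′; R556): verbatim copy of `Summit.QuantumFields.YangMills.Theorems.K0HalvingStepOfCore.not_mem_printedPlaqs_zero_of_mem_plaqsOf` — its module `…K0HalvingStepOfCore (p586684)` is residue after the Stage-2 seam and can no longer be imported on a green road; statement and proof byte-identical to the original, visibility `private` (no new public name, nothing restated for citers). -/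
private theorem not_mem_printedPlaqs_zero_of_mem_plaqsOf {F : T4Family} {K : ℕ} {ν : Stage7Numerics} {M : ℕ} {g : ℕ → ℝ} {k : ℕ} {s : SeqOfRecord F ν M g K k}
    (hsep : Sect2.SeqSeparated ν.M₁ s) (hM₁ : 0 < ν.M₁) {n : ℕ} (h2n : 2 ≤ n) (hnk : n ≤ k) {p : Plaq (F.P K) 0}
    (hp : p ∈ B8Eq17ClassAkV1.plaqsOf (s.Ω n)) : p ∉ Sect2.printedPlaqs s.Ω k 0 := by
  have hk : 0 < k := by omega
  have h1k : 1 < k := by omega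
  have hΩ2 : s.Ω n ⊆ s.Ω 2 := s.chain.Ω_antitone (by norm_num) h2n hnk
  have hΩ1 : s.Ω 2 ⊆ s.Ω 1 := s.chain.Ω_antitone le_rfl one_le_two (by omega)
  -- neighbours of a point of `Ω₂` lie in `Ω₁`
  have hsh : ∀ {x : Site (F.P K) 0}, x ∈ s.Ω 2 → ∀ μ, x.shift μ ∈ s.Ω 1 := fun hx μ => hsep.shift_mem hM₁ le_rfl h1k hx μ
  have hush : ∀ {x : Site (F.P K) 0}, x ∈ s.Ω 2 → ∀ μ, x.unshift μ ∈ s.Ω 1 := fun hx μ => hsep.unshift_mem hM₁ le_rfl h1k hx μ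
  intro hpr
  obtain ⟨hb1, hb2, _, hb4⟩ := (mem_printedPlaqs_zero_iff_bonds s.Ω hk p).1 hpr
  rw [mem_bondsOf_genSet_zero_iff s.Ω hk] at hb1 hb2 hb4
  simp only [pts_zero] at hb1 hb2 hb4
  rcases (B8Eq17ClassAkV1.mem_plaqsOf _ _).1 hp with h | h | h | h
  · exact hb1 ⟨hΩ1 (hΩ2 h), hsh (hΩ2 h) p.μ⟩
  · refine hb1 ⟨?_, hΩ1 (hΩ2 h)⟩
    have := hush (hΩ2 h) p.μ
    rwa [unshift_shift_site] at this
  · refine hb4 ⟨?_, hΩ1 (hΩ2 h)⟩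
    have := hush (hΩ2 h) p.ν
    rwa [unshift_shift_site] at this
  · refine hb2 ⟨?_, hΩ1 (hΩ2 h)⟩
    have := hush (hΩ2 h) p.ν
    rwa [unshift_shift_site] at this
/-! ## §1  The pure-data plaquettes and bonds of the top class at print's datum -/
section PureData

variable {F : T4Family} {N : ℕ} [NeZero N]

/-- **A level-`0` plaquette with all four corners off `Ω₁` is a `Λ₀`-plaquette** («p′ ⊂ Λ₀», §7′'s `Sect2.lamPlaqs Ω k 0`; `0 < k`). [cite: Balaban1985Variational, (7) p.278 L20–33; Balaban1984PropagatorsII, (2.3) p.224] -/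
theorem mem_lamPlaqs_zero_of_corners {K : ℕ} {Ω : ℕ → Set (Site (F.P K) 0)} {k : ℕ} (hk : 0 < k) {q : Plaq (F.P K) 0}
    (h1 : q.src ∉ Ω 1) (h2 : q.src.shift q.μ ∉ Ω 1) (h3 : q.src.shift q.ν ∉ Ω 1) (h4 : (q.src.shift q.μ).shift q.ν ∉ Ω 1) : q ∈ Sect2.lamPlaqs Ω k 0 := by
  refine ⟨?_, fun _ => ⟨h1, h2, h3, h4⟩⟩
  show q ∈ B8Eq17ClassAkV1.plaqsOf (pts 0 (gammaRegion Ω k 0))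
  rw [gammaRegion_zero Ω hk, pts_zero]
  exact Or.inl h1

/-- **A `Λ₀`-PLAQUETTE IS PINNED BY THE (2.3) FIBRE** (`Ω₁` saturated by 1-blocks, `1 ≤ m + K`): its four bonds have both ends off `Ω₁` and both end-blocks off `Ω₁^{(1)}`, so they are
`Λ₀`-bonds (F0a `mem_lamBondsSeq_iff_zero`) and `U(∂p) = W₀(∂p)`. [cite: Balaban1984PropagatorsII, (2.3) p.224; Balaban1988Convergent, (2.10) p.256; Balaban1987RG1, (0.1)–(0.3) pp.251–252] -/
theorem plaqHol_eq_of_agreeOnB_of_mem_lamPlaqs_zero {K k : ℕ} (hk : 0 < k) {Ω : ℕ → Set (Site (F.P K) 0)} (hK1 : 0 + 1 ≤ (F.P K).m + (F.P K).K)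
    (hsat1 : ∀ x x' : Site (F.P K) 0, iterBlockOf (0 + 1) x = iterBlockOf (0 + 1) x' → x ∈ Ω (0 + 1) → x' ∈ Ω (0 + 1))
    {W : MSField (F.P K) (SU N)} {U : GaugeField (F.P K) 0 (SU N)} (hfib : AgreeOnB (lamBondsSeq Ω k) (avgFamily (avOfRecord F N K) U) W)
    {p : Plaq (F.P K) 0} (hp : p ∈ Sect2.lamPlaqs Ω k 0) : GaugeField.plaqHol U p = GaugeField.plaqHol (W 0) p := by
  obtain ⟨c1, c2, c3, c4⟩ := hp.2 hk
  have hd : ∀ c : Site (F.P K) 0, c ∉ pts 0 (Ω (0 + 1)) → blockOf c ∉ pts (0 + 1) (Ω (0 + 1)) :=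
    fun c hc h => hc ((mem_pts_iff_blockOf_mem_pts_of_saturated hK1 hsat1 c).2 h)
  have hb : ∀ b : PBond (F.P K) 0, b.src ∉ pts 0 (Ω (0 + 1)) → b.tgt ∉ pts 0 (Ω (0 + 1)) → U b = W 0 b := by
    intro b hs ht
    refine hfib 0 b ((mem_lamBondsSeq_iff_zero Ω k hk b).2 ⟨Or.inl hs, hd _ hs, hd _ ht⟩)
  have hcomm : (p.src.shift p.ν).shift p.μ = (p.src.shift p.μ).shift p.ν := shift_shift_comm_site_b p.src p.hμν.ne
  simp only [GaugeField.plaqHol]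
  rw [hb ⟨p.src, p.μ⟩ c1 c2, hb ⟨p.src.shift p.μ, p.ν⟩ c2 c4, hb ⟨p.src.shift p.ν, p.μ⟩ c3 (by show (p.src.shift p.ν).shift p.μ ∉ _; rw [hcomm]; exact c4),
    hb ⟨p.src, p.ν⟩ c1 c3]

/-- ★ **(8)'s (1.7)-MEMBER AT A `Λ₀`-PLAQUETTE OF THE TOP CLASS IS PRINT's DATA**: on the (2.3) fibre a `Λ₀`-plaquette meeting the top domain reads `U(∂p) = W₀(∂p)`, and print's (7) for
the top domain (`Sect2.DataSmall7LamTop`, range `Sect2.lamPlaqsTop`) bounds it by `δ₀`. [cite: Balaban1985Variational, (3),(7) p.278 L20–33; Balaban1984PropagatorsII, (2.3) p.224; Balaban1988Convergent, (2.10)–(2.12) p.256] -/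
theorem dist1_plaqHol_lt_of_mem_lamPlaqs {K k : ℕ} (hk : 0 < k) {Ω : ℕ → Set (Site (F.P K) 0)} (hK1 : 0 + 1 ≤ (F.P K).m + (F.P K).K)
    (hsat1 : ∀ x x' : Site (F.P K) 0, iterBlockOf (0 + 1) x = iterBlockOf (0 + 1) x' → x ∈ Ω (0 + 1) → x' ∈ Ω (0 + 1))
    {Ω₀ : Set (Site (F.P K) 0)} {δ : ℕ → ℝ} {W : MSField (F.P K) (SU N)} (h7 : Sect2.DataSmall7LamTop (avOfRecord F N K) Ω Ω₀ k δ W) {U : GaugeField (F.P K) 0 (SU N)}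
    (hfib : AgreeOnB (lamBondsSeq Ω k) (avgFamily (avOfRecord F N K) U) W) {p : Plaq (F.P K) 0} (hpr : p ∈ Sect2.lamPlaqs Ω k 0)
    (hpΩ₀ : p ∈ B8Eq17ClassAkV1.plaqsOf Ω₀) : dist1 (GaugeField.plaqHol U p) < δ 0 := by
  rw [plaqHol_eq_of_agreeOnB_of_mem_lamPlaqs_zero hk hK1 hsat1 hfib hpr]
  exact h7.1 p ⟨hpr, hpΩ₀⟩

/-- ★ **(8)'s (1.9)-MEMBER AT A FAR BOND IS PRINT's DATA**: for a bond of the top domain whose end-points and all their nearest neighbours lie off `Ω₁` (`Sect2.bondsDeep (Ω₁)ᶜ`), every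
plaquette of its co-divergence stencil has ALL FOUR corners off `Ω₁` — a `Λ₀`-plaquette meeting the top domain, pinned print data `< δ₀` — and `‖η·(D^{η*}_U∂U)(b)‖ ≤ d·2δ₀`
(`Sect2.norm_coDivSum_le_of_stencil`). [cite: Balaban1985RegularSpaces, (1.1)–(1.2) p.76, (1.5),(1.9) p.77; Balaban1985Variational, (7) p.278; Balaban1984PropagatorsII, (2.3) p.224] -/
theorem norm_coDivSum_le_of_mem_bondsDeep_compl_lam {K k : ℕ} (hk : 0 < k) {Ω : ℕ → Set (Site (F.P K) 0)} (hK1 : 0 + 1 ≤ (F.P K).m + (F.P K).K)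
    (hsat1 : ∀ x x' : Site (F.P K) 0, iterBlockOf (0 + 1) x = iterBlockOf (0 + 1) x' → x ∈ Ω (0 + 1) → x' ∈ Ω (0 + 1))
    {Ω₀ : Set (Site (F.P K) 0)} {δ : ℕ → ℝ} (hδ0 : 0 ≤ δ 0) {W : MSField (F.P K) (SU N)} (h7 : Sect2.DataSmall7LamTop (avOfRecord F N K) Ω Ω₀ k δ W)
    {U : GaugeField (F.P K) 0 (SU N)} (hfib : AgreeOnB (lamBondsSeq Ω k) (avgFamily (avOfRecord F N K) U) W) {b : PBond (F.P K) 0} (hb : b ∈ bondsOf Ω₀)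
    (hbd : b ∈ Sect2.bondsDeep (Ω 1)ᶜ) : ‖Sect2.coDivSum U b.src b.dir‖ ≤ (F.P K).d * (2 * δ 0) := by
  obtain ⟨hx, hxμ, hnb⟩ := hbd
  have hxμ' : b.src.shift b.dir ∉ Ω 1 := hxμ
  have hx' : b.src ∉ Ω 1 := hx
  have key : ∀ q : Plaq (F.P K) 0, q.src ∉ Ω 1 → q.src.shift q.μ ∉ Ω 1 → q.src.shift q.ν ∉ Ω 1 → (q.src.shift q.μ).shift q.ν ∉ Ω 1 →
      q ∈ B8Eq17ClassAkV1.plaqsOf Ω₀ → dist1 (GaugeField.plaqHol U q) ≤ δ 0 := fun q h1 h2 h3 h4 hq =>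
    (dist1_plaqHol_lt_of_mem_lamPlaqs hk hK1 hsat1 h7 hfib (mem_lamPlaqs_zero_of_corners hk h1 h2 h3 h4) hq).le
  have hbΩ₀ : b.src ∈ Ω₀ ∨ b.src.shift b.dir ∈ Ω₀ := hb
  refine Sect2.norm_coDivSum_le_of_stencil U hδ0 b.src b.dir (fun ν h => ⟨?_, ?_⟩) (fun ν h => ⟨?_, ?_⟩)
  · -- `p_{νμ}(x − e_ν)`: corners `x − e_ν`, `x`, `(x + e_μ) − e_ν`, `x + e_μ`
    refine key ⟨b.src.unshift ν, ν, b.dir, h⟩ (hnb ν).2.1 ?_ ?_ ?_ ?_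
    · show (b.src.unshift ν).shift ν ∉ Ω 1
      rw [shift_unshift_site_b]; exact hx'
    · show (b.src.unshift ν).shift b.dir ∉ Ω 1
      rw [unshift_shift_comm_site_b]; exact (hnb ν).2.2.2
    · show ((b.src.unshift ν).shift ν).shift b.dir ∉ Ω 1
      rw [shift_unshift_site_b]; exact hxμ'
    · rcases hbΩ₀ with h0 | h0
      · exact Or.inr (Or.inl (by show (b.src.unshift ν).shift ν ∈ Ω₀; rw [shift_unshift_site_b]; exact h0))
      · refine Or.inr (Or.inr (Or.inr ?_))
        show ((b.src.unshift ν).shift ν).shift b.dir ∈ Ω₀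
        rw [shift_unshift_site_b]; exact h0
  · -- `p_{νμ}(x)`: corners `x`, `x + e_ν`, `x + e_μ`, `(x + e_ν) + e_μ = (x + e_μ) + e_ν`
    refine key ⟨b.src, ν, b.dir, h⟩ hx' (hnb ν).1 hxμ' ?_ ?_
    · show (b.src.shift ν).shift b.dir ∉ Ω 1
      rw [shift_shift_comm_site_b b.src h.ne']; exact (hnb ν).2.2.1
    · rcases hbΩ₀ with h0 | h0
      · exact Or.inl h0
      · exact Or.inr (Or.inr (Or.inl h0))
  · -- `p_{μν}(x − e_ν)`: corners `x − e_ν`, `(x + e_μ) − e_ν`, `x`, `x + e_μ`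
    refine key ⟨b.src.unshift ν, b.dir, ν, h⟩ (hnb ν).2.1 ?_ ?_ ?_ ?_
    · show (b.src.unshift ν).shift b.dir ∉ Ω 1
      rw [unshift_shift_comm_site_b]; exact (hnb ν).2.2.2
    · show (b.src.unshift ν).shift ν ∉ Ω 1
      rw [shift_unshift_site_b]; exact hx'
    · show ((b.src.unshift ν).shift b.dir).shift ν ∉ Ω 1
      rw [unshift_shift_comm_site_b, shift_unshift_site_b]; exact hxμ'
    · rcases hbΩ₀ with h0 | h0
      · refine Or.inr (Or.inr (Or.inl ?_))
        show (b.src.unshift ν).shift ν ∈ Ω₀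
        rw [shift_unshift_site_b]; exact h0
      · refine Or.inr (Or.inr (Or.inr ?_))
        show ((b.src.unshift ν).shift b.dir).shift ν ∈ Ω₀
        rw [unshift_shift_comm_site_b, shift_unshift_site_b]; exact h0
  · -- `p_{μν}(x)`: corners `x`, `x + e_μ`, `x + e_ν`, `(x + e_μ) + e_ν`
    refine key ⟨b.src, b.dir, ν, h⟩ hx' hxμ' (hnb ν).1 (hnb ν).2.2.1 ?_
    rcases hbΩ₀ with h0 | h0
    · exact Or.inl h0
    · exact Or.inr (Or.inl h0)

end PureData
/-! ## §2  ★★ `HalvingStepTopGB` FROM ITS CORE AT PRINT's LEVEL-0 RANGE (the floor `2L² ≤ B₃`, the top domain containing `Ω₁`, `Ω₁` saturated) -/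
section Main

variable {F : T4Family} {N : ℕ} [NeZero N]

/-- ★★ **[15] SECT. F's ONE-STEP IMPROVEMENT AT THE OBJECTS OF ONE RUN, FROM ITS CORE AT PRINT's LEVEL-0 RANGE, POINTWISE** — print-datum twin of `K0HalvingStepOfCoreFloor.halvingStep_top_of_core_at`
(FLAG №16 ∕ LOCATE-HSEAM 5d3298b8d191f169; the (b)-instance stays landed and true on its own text): at a separated run with `Ω₁ ⊆ Sup₀`, `Ω₁` saturated by 1-blocks, `2L² ≤ B₃`, print's
top-domain (7) `Sect2.DataSmall7LamTop` and a configuration on the (2.3) fibre, the CORE pair (one-step bound at the plaquettes NOT in `Sect2.lamPlaqs s.Ω k 0` and at the bonds NOT far from `Ω₁`)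
yields the FULL pair.  `Λ₀`-plaquettes are pinned data `< δ₀ ≤ B₃δ₀`; the level-1 ones (corner plaquettes of `Ω₁`, none under (2.3) but the case is uniform) `< δ₀ ≤ 2δ₁ ≤ B₃δ₁·L⁻²`
(the floor); none meets `Ω_n`, `n ≥ 2` (separation; `lamPlaqs ⊆ printedPlaqs`); a far bond reads `2d = 8` pinned plaquettes `≤ 8δ₀ < B₃δ₀`, and no bond meeting `Ω_n ⊆ Ω₁` is far.
[cite: Balaban1985Variational, Sect. F p.304, (2),(3),(7),(8) p.278, Prop. 8 p.304; Balaban1985RegularSpaces, (1.2) p.76, (1.3)–(1.9) p.77; Balaban1984PropagatorsII, (2.3) p.224; Balaban1988Convergent, (2.10)–(2.12) p.256] -/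
theorem halvingStep_top_of_core_at_lam {K : ℕ} {ν : Stage7Numerics} {M : ℕ} {g : ℕ → ℝ} {k : ℕ} {s : SeqOfRecord F ν M g K k}
    (hsep : Sect2.SeqSeparated ν.M₁ s) (hM₁ : 0 < ν.M₁) (hk : 1 ≤ k) (hK1 : 0 + 1 ≤ (F.P K).m + (F.P K).K)
    (hsat1 : ∀ x x' : Site (F.P K) 0, iterBlockOf (0 + 1) x = iterBlockOf (0 + 1) x' → x ∈ s.Ω (0 + 1) → x' ∈ s.Ω (0 + 1))
    {Sup₀ : Set (Site (F.P K) 0)} (hΩ1Sup : s.Ω 1 ⊆ Sup₀)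
    {B₃ : ℝ} (hB₃ : 2 * (F.L : ℝ) ^ 2 ≤ B₃) {ε δ : ℕ → ℝ} (hδ0 : 0 < δ 0) (hcomp0 : δ 0 ≤ 2 * δ 1)
    {W : MSField (F.P K) (SU N)} (h7 : Sect2.DataSmall7LamTop (avOfRecord F N K) s.Ω Sup₀ k δ W) {U : GaugeField (F.P K) 0 (SU N)}
    (hfib : AgreeOnB (lamBondsSeq s.Ω k) (avgFamily (avOfRecord F N K) U) W)
    (hP : ∀ n, n ≤ k → ∀ p ∈ Sect2.omegaPlaqsTop s.Ω Sup₀ n, p ∉ Sect2.lamPlaqs s.Ω k 0 →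
      dist1 (GaugeField.plaqHol U p) < max (B₃ * δ n) (ε n / 2) * (F.P K).eta n ^ 2)
    (hD : ∀ n, n ≤ k → ∀ b ∈ Sect2.omegaBondsTop s.Ω Sup₀ n, b ∉ Sect2.bondsDeep (s.Ω 1)ᶜ →
      ‖Sect2.coDivSum U b.src b.dir‖ < max (B₃ * δ n) (ε n / 2) * (F.P K).eta n ^ 3) :
    (∀ n, n ≤ k → PlaqSmallOn (Sect2.omegaPlaqsTop s.Ω Sup₀ n) (max (B₃ * δ n) (ε n / 2) * (F.P K).eta n ^ 2) U) ∧
      ∀ n, n ≤ k → Sect2.CoDivSmallOn (Sect2.omegaBondsTop s.Ω Sup₀ n) (max (B₃ * δ n) (ε n / 2) * (F.P K).eta n ^ 3) U := by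
  have hk0 : 0 < k := hk
  have hL11 : (11 : ℝ) < F.L := by exact_mod_cast F.hL11
  have hB₃8 : (8 : ℝ) < B₃ := by nlinarith
  have hB₃1 : (1 : ℝ) ≤ B₃ := by linarith
  have hplaqs : ∀ n, n ≤ k → Sect2.omegaPlaqsTop s.Ω Sup₀ n ⊆ B8Eq17ClassAkV1.plaqsOf Sup₀ := by
    intro n hn p hp
    rcases Nat.eq_zero_or_pos n with rfl | hn0
    · rwa [Sect2.omegaPlaqsTop_zero] at hp
    · rw [Sect2.omegaPlaqsTop_of_ne_zero _ _ hn0.ne', omegaPlaqs_of_ne_zero _ hn0.ne'] at hp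
      exact B8Eq17ClassAkV1.plaqsOf_mono ((s.chain.Ω_antitone le_rfl hn0 hn).trans hΩ1Sup) hp
  refine ⟨fun n hn p hp => ?_, fun n hn b hb => ?_⟩
  · -- (1.7) member
    by_cases hpr : p ∈ Sect2.lamPlaqs s.Ω k 0
    swap
    · exact hP n hn p hp hpr
    have hdata : dist1 (GaugeField.plaqHol U p) < δ 0 := dist1_plaqHol_lt_of_mem_lamPlaqs hk0 hK1 hsat1 h7 hfib hpr (hplaqs n hn hp)
    have hηn : 0 ≤ (F.P K).eta n := (pow_pos (inv_pos.mpr (Nat.cast_pos.mpr (F.P K).L_pos)) n).le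
    rcases Nat.lt_or_ge n 2 with hn2 | hn2
    · interval_cases n
      · -- level 0: `δ₀ ≤ B₃δ₀`
        have hη0 : (F.P K).eta 0 = 1 := by simp [Params.eta]
        rw [hη0, one_pow, mul_one]
        calc dist1 (GaugeField.plaqHol U p) < δ 0 := hdata
          _ ≤ B₃ * δ 0 := le_mul_of_one_le_left hδ0.le hB₃1
          _ ≤ max (B₃ * δ 0) (ε 0 / 2) := le_max_left _ _
      · -- level 1: `δ₀ ≤ 2δ₁ ≤ B₃δ₁·L⁻²` (the floor `2L² ≤ B₃`)
        have hη1 : (F.P K).eta 1 = (F.L : ℝ)⁻¹ := by simp [Params.eta]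
        have hLpos : (0 : ℝ) < F.L := by linarith
        rw [hη1]
        have hδ1 : 0 ≤ δ 1 := by linarith
        have hkey : 2 * δ 1 ≤ max (B₃ * δ 1) (ε 1 / 2) * (F.L : ℝ)⁻¹ ^ 2 := by
          calc 2 * δ 1 = (2 * (F.L : ℝ) ^ 2 * δ 1) * (F.L : ℝ)⁻¹ ^ 2 := by field_simp
            _ ≤ (B₃ * δ 1) * (F.L : ℝ)⁻¹ ^ 2 := by gcongr
            _ ≤ max (B₃ * δ 1) (ε 1 / 2) * (F.L : ℝ)⁻¹ ^ 2 := by gcongr; exact le_max_left _ _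
        linarith
    · -- levels `n ≥ 2`: no `Λ₀`-plaquette meets `Ω_n` (it is printed; separation)
      exfalso
      rw [Sect2.omegaPlaqsTop_of_ne_zero _ _ (by omega), omegaPlaqs_of_ne_zero _ (by omega)] at hp
      exact not_mem_printedPlaqs_zero_of_mem_plaqsOf hsep hM₁ hn2 hn hp (Sect2.lamPlaqs_subset_printedPlaqs_of_lt s.Ω k hk0 hpr)
  · -- (1.9) member
    by_cases hbd : b ∈ Sect2.bondsDeep (s.Ω 1)ᶜ
    swap
    · exact hD n hn b hb hbd
    rcases Nat.eq_zero_or_pos n with rfl | hn0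
    · -- level 0: a far bond of the top domain reads pinned data on its whole stencil
      rw [Sect2.omegaBondsTop_zero] at hb
      have hη0 : (F.P K).eta 0 = 1 := by simp [Params.eta]
      rw [hη0, one_pow, mul_one]
      have hle := norm_coDivSum_le_of_mem_bondsDeep_compl_lam hk0 hK1 hsat1 hδ0.le h7 hfib hb hbd
      rw [T4Family.P_d] at hle
      push_cast at hle
      calc ‖Sect2.coDivSum U b.src b.dir‖ ≤ 4 * (2 * δ 0) := hle
        _ < B₃ * δ 0 := by nlinarith
        _ ≤ max (B₃ * δ 0) (ε 0 / 2) := le_max_left _ _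
    · -- levels `n ≥ 1`: a bond meeting `Ω_n ⊆ Ω₁` is not far
      exfalso
      rw [Sect2.omegaBondsTop_of_ne_zero _ _ hn0.ne'] at hb
      have hb' : b ∈ bondsOf (s.Ω n) := by unfold Sect2.omegaBonds at hb; rwa [if_neg hn0.ne'] at hb
      have hΩn1 : s.Ω n ⊆ s.Ω 1 := s.chain.Ω_antitone le_rfl hn0 hn
      rcases hb' with h1 | h1
      · exact hbd.1 (hΩn1 h1)
      · exact hbd.2.1 (hΩn1 h1)

/-- ★★ **[15] SECT. F's ONE-STEP IMPROVEMENT UNDER A GUARD, FROM ITS CORE FORM, AT PRINT's DATUM** — print-datum twin of `K0HalvingStepOfCoreFloor.halvingStepTopG_of_coreG` (FLAG №16 ∕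
LOCATE-HSEAM 5d3298b8d191f169; the (b)-instance stays landed and true on its own text): if the top domain contains `Ω₁` whenever `0 < M₁`, `2L² ≤ B₃`, and the guard gives the standing
range `k ≤ m + K` and the grid numerics (so that `Ω₁` is saturated by 1-blocks, `blockSat_seqOfRecord`), then
`HalvingStepTopCoreGB F N Sup Adm (lamDatum F) (dataSmall7LamTopOf F N) (lamPlaqs0Of F) B₃ a₀ a₁ ⇒ HalvingStepTopGB F N Sup Adm (lamDatum F) (dataSmall7LamTopOf F N) B₃ a₀ a₁`.
[cite: Balaban1985Variational, Sect. F p.304, (7),(8) p.278, Prop. 8 p.304; Balaban1985RegularSpaces, (1.3)–(1.9) p.77; Balaban1984PropagatorsII, (2.3) p.224; Balaban1987RG1, (0.1) p.251] -/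
theorem halvingStepTopGB_of_coreGB_lam {Sup : (ν : Stage7Numerics) → (K : ℕ) → (ℕ → Set (Site (F.P K) 0)) → Set (Site (F.P K) 0)} {Adm : StepGuard F} {B₃ a₀ a₁ : ℝ}
    (hSup : ∀ (ν : Stage7Numerics) (K : ℕ) (Ω : ℕ → Set (Site (F.P K) 0)), 0 < ν.M₁ → Ω 1 ⊆ Sup ν K Ω)
    (hAdmK : ∀ (ν : Stage7Numerics) (M : ℕ) (g : ℕ → ℝ) (K k : ℕ) (s : SeqOfRecord F ν M g K k), Adm ν M g K k s → k ≤ (F.P K).m + (F.P K).K)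
    (hAdmG : ∀ (ν : Stage7Numerics) (M : ℕ) (g : ℕ → ℝ) (K k : ℕ) (s : SeqOfRecord F ν M g K k), Adm ν M g K k s → ∀ j : ℕ, 1 ≤ j → j ≤ k →
      dCubeSide (F.P K).L M (RkOfRecord (F.P K).L ν.r (g j)) j ∣ (F.P K).sitesPerDir 0)
    (hB₃ : 2 * (F.L : ℝ) ^ 2 ≤ B₃) (h : HalvingStepTopCoreGB F N Sup Adm (lamDatum F) (dataSmall7LamTopOf F N) (lamPlaqs0Of F) B₃ a₀ a₁) :
    HalvingStepTopGB F N Sup Adm (lamDatum F) (dataSmall7LamTopOf F N) B₃ a₀ a₁ := by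
  intro ν M g K k s hsep hM₁ hadm hk ε δ hδ hcomp hcomp' hε hεcomp hεcomp' W h7 U h17 h19 hfib hcrit
  obtain ⟨hP, hD⟩ := h ν M g K k s hsep hM₁ hadm hk ε δ hδ hcomp hcomp' hε hεcomp hεcomp' W h7 U h17 h19 hfib hcrit
  have hkK : k ≤ (F.P K).m + (F.P K).K := hAdmK ν M g K k s hadm
  have hsat1 : ∀ x x' : Site (F.P K) 0, iterBlockOf (0 + 1) x = iterBlockOf (0 + 1) x' → x ∈ s.Ω (0 + 1) → x' ∈ s.Ω (0 + 1) :=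
    fun x x' => blockSat_seqOfRecord F ν M g K k hkK s (hAdmG ν M g K k s hadm) (0 + 1) x x' (by omega) (by omega)
  exact halvingStep_top_of_core_at_lam hsep hM₁ hk (by omega) hsat1 (hSup ν K s.Ω hM₁) hB₃ (hδ 0 (Nat.zero_le _)).1 (hcomp 0 hk) h7 hfib hP hD

/-- ★ **PROPOSITION 8's TOP STEP UNDER A GUARD FROM THE GUARDED CORE ONE-STEP FACT AT PRINT's DATUM, AT THE SUPPORT OF RECORD** (`Ω₁ ⊆ suppDomOfRecord …`; F0c's
`prop8RegSepTopStepGB_of_coreGB_of_link` with its `hlink` DISCHARGED by `halvingStepTopGB_of_coreGB_lam`; `0 < B₃` from `2L² ≤ B₃`). [cite: Balaban1985Variational, Prop. 8 p.304, Sect. F pp.300–304; Balaban1988Convergent, p.255; Balaban1984PropagatorsII, (2.3) p.224] -/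
theorem prop8RegSepTopStepGB_of_coreGB_lam {Adm : StepGuard F} {B₃ a₀ a₁ : ℝ}
    (hAdmK : ∀ (ν : Stage7Numerics) (M : ℕ) (g : ℕ → ℝ) (K k : ℕ) (s : SeqOfRecord F ν M g K k), Adm ν M g K k s → k ≤ (F.P K).m + (F.P K).K)
    (hAdmG : ∀ (ν : Stage7Numerics) (M : ℕ) (g : ℕ → ℝ) (K k : ℕ) (s : SeqOfRecord F ν M g K k), Adm ν M g K k s → ∀ j : ℕ, 1 ≤ j → j ≤ k →
      dCubeSide (F.P K).L M (RkOfRecord (F.P K).L ν.r (g j)) j ∣ (F.P K).sitesPerDir 0)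
    (hB₃ : 2 * (F.L : ℝ) ^ 2 ≤ B₃)
    (h : HalvingStepTopCoreGB F N (fun ν K Ω => suppDomOfRecord F ν K Ω) Adm (lamDatum F) (dataSmall7LamTopOf F N) (lamPlaqs0Of F) B₃ a₀ a₁) :
    Prop8RegSepTopStepGB F N (fun ν K Ω => suppDomOfRecord F ν K Ω) Adm (lamDatum F) (dataSmall7LamTopOf F N) B₃ a₀ a₁ := by
  have hL11 : (11 : ℝ) < F.L := by exact_mod_cast F.hL11
  have hB₃0 : 0 < B₃ := by nlinarith
  exact prop8RegSepTopStepGB_of_coreGB_of_link hB₃0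
    (halvingStepTopGB_of_coreGB_lam (fun ν K Ω hM₁ => (subset_hullD_self (F.P K) ν.M₁ hM₁ 1 (Ω 1))) hAdmK hAdmG hB₃) h

end Main
/-! ## §3  The per-datum split token ⇒ the core token AT PRINT's LEVEL-0 RANGE ⇒ Proposition 8's top step, at `(lamDatum F, dataSmall7LamTopOf F N)` -/
section Chain

variable {P : Params} in
/-- **A CORE PLAQUETTE OF PRINT's LEVEL-0 RANGE MEETS `Ω₁`**: if `p ∉ Sect2.lamPlaqs Ω k 0` (`0 < k`) — NOT «all four corners in `Λ₀ = Ω₁ᶜ`» — then some corner lies in `Ω₁`,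
`p ∈ plaqsOf (Ω 1)` (dag-n07-w4's `…_of_not_mem_printedPlaqs_zero` needed three corners; print's range asks four). [cite: Balaban1985Variational, (7) p.278 L20–33, p.302; Balaban1984PropagatorsII, (2.3) p.224] -/
theorem Sect2.mem_plaqsOf_one_of_not_mem_lamPlaqs_zero {Ω : ℕ → Set (Site P 0)} {k : ℕ} (hk : 0 < k) {p : Plaq P 0}
    (h : p ∉ Sect2.lamPlaqs Ω k 0) : p ∈ B8Eq17ClassAkV1.plaqsOf (Ω 1) := by
  by_contra hcon
  have hc : p.src ∉ Ω 1 ∧ p.src.shift p.μ ∉ Ω 1 ∧ p.src.shift p.ν ∉ Ω 1 ∧ (p.src.shift p.μ).shift p.ν ∉ Ω 1 := by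
    simpa only [B8Eq17ClassAkV1.plaqsOf, Set.mem_setOf_eq, not_or] using hcon
  apply h
  refine ⟨?_, fun _ => hc⟩
  show p ∈ B8Eq17ClassAkV1.plaqsOf (pts 0 (B15DeterminingSets.gammaRegion Ω k 0))
  rw [gammaRegion_zero Ω hk, pts_zero]
  exact Or.inl hc.1

variable {P : Params} in
/-- ★ **THE LEVEL OF A CORE PLAQUETTE, PRINT's LEVEL-0 RANGE**: a plaquette of the level-`m` top class that is CORE for print's range (`p ∉ Sect2.lamPlaqs Ω k 0`) meets `Ω_j` for some `j` with
`max m 1 ≤ j ≤ k` (dag-n07-w4's `Sect2.exists_level_of_core_plaq` verbatim with the lemma above at `m = 0`). [cite: Balaban1985Variational, p.302, (7) p.278; Balaban1985RegularSpaces, (1.7) p.77] -/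
theorem Sect2.exists_level_of_core_plaq_lam {Ω : ℕ → Set (Site P 0)} {Ω₀ : Set (Site P 0)} {k m : ℕ} (hk : 1 ≤ k) (hm : m ≤ k) {p : Plaq P 0}
    (hp : p ∈ Sect2.omegaPlaqsTop Ω Ω₀ m) (hcore : p ∉ Sect2.lamPlaqs Ω k 0) :
    ∃ j, max m 1 ≤ j ∧ j ≤ k ∧ p ∈ B8Eq17ClassAkV1.plaqsOf (Ω j) := by
  by_cases hm0 : m = 0
  · subst hm0
    exact ⟨1, by simp, hk, Sect2.mem_plaqsOf_one_of_not_mem_lamPlaqs_zero hk hcore⟩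
  · refine ⟨m, by simp [Nat.one_le_iff_ne_zero.mpr hm0], hm, ?_⟩
    rwa [Sect2.omegaPlaqsTop_of_ne_zero Ω Ω₀ hm0, omegaPlaqs_of_ne_zero Ω hm0] at hp

variable {F : T4Family} {N : ℕ} [NeZero N]

/-- ★★ **THE ∃-INTRODUCTION OF THE S6 HEAD OVER `(bd, Dat)`, SPLIT EDITION, AT PRINT's LEVEL-0 EXCLUSION `lamPlaqs0Of F`** — dag-n07-w4's `localLettersSplitCoreG_of_datumGaugeSplitCoreG` (dag-n07-w3's
`(bd, Dat)` edition at `printedPlaqs0Of F`) with print's SMALLER exclusion: every level-0 plaquette with a corner in `Ω₁` is covered by a level-1 datum's print box, exactly as before.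
[cite: Balaban1985Variational, p.304, p.302, (165) p.304, (7) p.278; Balaban1985RegularSpaces, (1.7)–(1.9) p.77, (1.2) p.76; Balaban1984PropagatorsII, (2.3) p.224] -/
theorem localLettersSplitCoreGB_of_datumGaugeSplitCoreGB_lam {Sup : (ν : Stage7Numerics) → (K : ℕ) → (ℕ → Set (Site (F.P K) 0)) → Set (Site (F.P K) 0)}
    {Mc ρ : ℕ} {Adm : StepGuard F} {bd : BondDatum F} {Dat : TopData F N} (hMc : 1 ≤ Mc) (hρ : F.L ≤ ρ) {B₃ C θ Q κ a₀ a₁ : ℝ}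
    (h : DatumGaugeSplitTopStepCoreGB F N Sup Mc ρ Adm bd Dat B₃ C θ Q κ a₀ a₁) :
    LocalLettersSplitTopStepCoreGB F N Sup Adm bd Dat (lamPlaqs0Of F) B₃ C θ Q κ a₀ a₁ := by
  intro ν M g K k s hsep hM₁ hc hk ε δ hδ hcomp hcomp' hε hεcomp hεcomp' W h7 U h17 h19 hfib hcrit m hm
  have hD := h ν M g K k s hsep hM₁ hc hk ε δ hδ hcomp hcomp' hε hεcomp hεcomp' W h7 U h17 h19 hfib hcrit
  have hρK : (F.P K).L ≤ ρ := hρ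
  have hS : ∀ j, 0 < side (F.P K).L Mc j := fun j => B14.Eq213MaximalDomains.side_pos (F.P K).L_pos hMc j
  refine ⟨fun p hp hcore => ?_, fun b hb hcore => ?_⟩
  · obtain ⟨j, hmj, hjk, hpj⟩ := Sect2.exists_level_of_core_plaq_lam hk hm hp hcore
    have hj : 1 ≤ j := le_trans (le_max_right m 1) hmj
    obtain ⟨y, hy, hxy⟩ := exists_within_three_of_mem_plaqsOf hpj
    have hg := hD j hj hjk (cubeIdx (side (F.P K).L Mc j) (lift (F.P K) p.src))
      ⟨lift (F.P K) p.src, y, mem_cubeExt_cubeIdx (hS j) _, hy, hxy⟩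
    exact ⟨_, j, le_trans (le_max_left m 1) hmj, hjk, Sect2.mem_plaqInside_cover_box_propCubeP p hj hMc hρK, hg⟩
  · obtain ⟨j, hmj, hjk, hbj⟩ := Sect2.exists_level_of_core_bond hk hm hb hcore
    have hj : 1 ≤ j := le_trans (le_max_right m 1) hmj
    obtain ⟨y, hy, hxy⟩ := exists_within_three_of_not_mem_bondsDeep_compl hbj
    have hg := hD j hj hjk (cubeIdx (side (F.P K).L Mc j) (lift (F.P K) b.src - fun _ => 1))
      ⟨lift (F.P K) b.src - fun _ => 1, y, mem_cubeExt_cubeIdx (hS j) _, hy, hxy⟩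
    exact ⟨_, j, le_trans (le_max_left m 1) hmj, hjk, Sect2.mem_bondsDeep_cover_box_propCubeP b hj hMc hρK, hg⟩

/-- ★★ **THE PER-DATUM SPLIT GAUGES OVER `(bd, Dat)` CLOSE THE ONE-STEP IMPROVEMENT OVER `(bd, Dat, lamPlaqs0Of F)`** (composition with dag-n07-w3's `halvingStepTopCoreGB_of_localLettersSplitCoreGB`,
generic `Ex0`; SAME smallness letters). [cite: Balaban1985Variational, (165)–(168) p.304, (162)–(163) pp.303–304, Prop. 8 p.304; Balaban1985RegularSpaces, (1.7)–(1.9) p.77, (1.54) p.85] -/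
theorem halvingStepTopCoreGB_of_datumGaugeSplitCoreGB_lam {Sup : (ν : Stage7Numerics) → (K : ℕ) → (ℕ → Set (Site (F.P K) 0)) → Set (Site (F.P K) 0)}
    {Mc ρ : ℕ} {Adm : StepGuard F} {bd : BondDatum F} {Dat : TopData F N} (hMc : 1 ≤ Mc) (hρ : F.L ≤ ρ) {B₃ C θ Q κ a₀ a₁ : ℝ}
    (h : DatumGaugeSplitTopStepCoreGB F N Sup Mc ρ Adm bd Dat B₃ C θ Q κ a₀ a₁)
    (hB₃ : 0 ≤ B₃) (hC : 4 * C ≤ B₃) (hθ : 16 * θ ≤ 1) (hQ : 0 ≤ Q) (hκ : 0 ≤ κ) (ha : (16 * Q + 1024 * κ ^ 2) * a₀ ≤ 1)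
    (hκa : 32 * κ * a₀ ≤ 1) : HalvingStepTopCoreGB F N Sup Adm bd Dat (lamPlaqs0Of F) B₃ a₀ a₁ :=
  halvingStepTopCoreGB_of_localLettersSplitCoreGB (localLettersSplitCoreGB_of_datumGaugeSplitCoreGB_lam hMc hρ h) hB₃ hC hθ hQ hκ ha hκa

/-- ★★★ **THE CORE-TO-TOP CHAIN END TO END AT PRINT's DATUM**: the guarded per-datum split token at `(lamDatum F, dataSmall7LamTopOf F N)` and the support of record gives [15] PROPOSITION 8's TOP
STEP `Prop8RegSepTopStepGB F N suppDom Adm (lamDatum F) (dataSmall7LamTopOf F N) B₃ a₀ a₁` — print-datum twin of `K0HalvingStepOfCoreGuardedChain.prop8RegSepTopStepG_of_datumGaugeSplitCoreG`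
(FLAG №16 ∕ LOCATE-HSEAM 5d3298b8d191f169; the (b)-instance stays landed and true on its own text), SAME letters (`2L² ≤ B₃`, `4C ≤ B₃`, `16θ ≤ 1`, `0 ≤ Q`, `0 ≤ κ`, `(16Q + 1024κ²)a₀ ≤ 1`,
`32κa₀ ≤ 1`) plus the guard's standing range and grid numerics (DISPLAYED: the 1-block saturation of `Ω₁` pins the `Λ₀`-plaquettes).
[cite: Balaban1985Variational, Prop. 8 p.304, Sect. F pp.300–304, (165)–(168) p.304, (7) p.278; Balaban1984PropagatorsII, (2.3) p.224; Balaban1988Convergent, p.255, (2.10) p.256] -/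
theorem prop8RegSepTopStepGB_of_datumGaugeSplitCoreGB_lam {Mc ρ : ℕ} {Adm : StepGuard F} (hMc : 1 ≤ Mc) (hρ : F.L ≤ ρ)
    (hAdmK : ∀ (ν : Stage7Numerics) (M : ℕ) (g : ℕ → ℝ) (K k : ℕ) (s : SeqOfRecord F ν M g K k), Adm ν M g K k s → k ≤ (F.P K).m + (F.P K).K)
    (hAdmG : ∀ (ν : Stage7Numerics) (M : ℕ) (g : ℕ → ℝ) (K k : ℕ) (s : SeqOfRecord F ν M g K k), Adm ν M g K k s → ∀ j : ℕ, 1 ≤ j → j ≤ k →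
      dCubeSide (F.P K).L M (RkOfRecord (F.P K).L ν.r (g j)) j ∣ (F.P K).sitesPerDir 0)
    {B₃ C θ Q κ a₀ a₁ : ℝ}
    (h : DatumGaugeSplitTopStepCoreGB F N (fun ν K Ω => suppDomOfRecord F ν K Ω) Mc ρ Adm (lamDatum F) (dataSmall7LamTopOf F N) B₃ C θ Q κ a₀ a₁)
    (hB₃ : 2 * (F.L : ℝ) ^ 2 ≤ B₃) (hC : 4 * C ≤ B₃) (hθ : 16 * θ ≤ 1) (hQ : 0 ≤ Q) (hκ : 0 ≤ κ) (ha : (16 * Q + 1024 * κ ^ 2) * a₀ ≤ 1)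
    (hκa : 32 * κ * a₀ ≤ 1) :
    Prop8RegSepTopStepGB F N (fun ν K Ω => suppDomOfRecord F ν K Ω) Adm (lamDatum F) (dataSmall7LamTopOf F N) B₃ a₀ a₁ := by
  have hL11 : (11 : ℝ) < F.L := by exact_mod_cast F.hL11
  have hB₃0 : 0 ≤ B₃ := by nlinarith
  exact prop8RegSepTopStepGB_of_coreGB_lam hAdmK hAdmG hB₃ (halvingStepTopCoreGB_of_datumGaugeSplitCoreGB_lam hMc hρ h hB₃0 hC hθ hQ hκ ha hκa)

end Chain
end Summit.QuantumFields.YangMills.Theorems.K0HalvingStepOfCoreB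
end
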